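import Summits.HodgeConjecture.HodgeConjecture.Theorems.Ring2WeilCoverageWeilGramSign
import Summits.HodgeConjecture.HodgeConjecture.Theorems.Ring2WeilCoverageWeilGramLevel20
import Summits.HodgeConjecture.HodgeConjecture.Theorems.Ring2WeilCoverageRealUnitNormHalfSystems
import Summits.HodgeConjecture.HodgeConjecture.Theorems.Ring2WeilCoverageNormTable
import Mathlib.Tactic.ComputeDegree
import HarnessLib

/-!
# Weil-type family coverage — THE COMPONENTS OF THE WEIL-TYPE `ℤ[ζ₁₆]`-FOURFOLDS, I: `K_d = ℚ(i)` (`i = ζ⁴`) at the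
# EXCEPTIONAL level `16` (units of norm `−1` exist, no THEOREM L (i)): the principal-type form `E_ξ` has Gram
# determinant `8 = 2·2²` in the real frame `1, θ, θ², θ³` of `ℚ(ζ₁₆)⁺`; a `Φ`-POSITIVE principal-type `ζ′` on a
# `ℚ(i)`-signature-`(2,2)` type has `det a = +8` by van Geemen's SIGN (part 92) — class `[2] = [1]`: SPLIT, row W4.1.1

research route conditional on HC_CM; not a corollary; Q11.4-sentence-2 already refuted in dim ≥ 3.

Ring 2, WEIL-TYPE FAMILY-COVERAGE CENSUS (`HOME/WEIL-FAMILY-COVERAGE.md` `## b01`, blocks b01.46 (the level-`16` rows: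
every type occurs on every `ℤ[ζ₁₆]`-torus, part 76) and b01.47 (C4) «LEVEL `16` computed, NOT filed — no THEOREM L (i)
there, so no unit invariance; the sign theorem of part 92 is what pins the class»; owner ring2-b01), part 94 of the
`Ring2WeilCoverage*` series (`K = ℚ(ζ₁₆)`, `Φ₁₆ = x⁸ + 1`, `ξ = ζ³/Φ₁₆′(ζ)`, frame `θ^i`, `θ = ζ + ζ⁻¹`).

* §0 level lemmas (`ζ⁸ = −1`, `θζ = ζ² + 1`, `i = ζ⁴` skew, `i² = −1`) and the evaluation step (`aeval_poly₈` is part 87's); §1 the seven traces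
  `Tr(ξ·ζ⁴·θ^m)` and the Gram datum: `b = 0`, **`a = −(1,0,2,0 / 0,2,0,6 / 2,0,6,0 / 0,6,0,20)`, `det a = 8`**; §3 `θ^i`
  is a `ℚ`-basis of `ℚ(ζ₁₆)⁺ = ℚ(√(2+√2))`.
* §4 At `16` a real unit may have norm `−1` (part 73: Hasse's unit), so a principal-type `ζ′ = uξ` has `det a = N(u)·8 =
  ±8` (part 82 `det_realPart_mul`); **`det_realPart_principal_pos_sqrtNegOne`: if moreover `ζ′` is `Φ`-POSITIVE on a CM
  type `Φ` of `ζ⁴`-signature `(2, 2)`, then `det a = 8`** (part 92 `neg_one_pow_mul_det_realPart_pos`: `0 < (−1)² det a`)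
  — such `ζ′` exist for EVERY `Φ` (part 76 `exists_principal_sixteen`); class **`[8] = [1]`** in `ℚˣ/Nm(ℚ(i)ˣ)`
  (`8 = 2² + 2²`): the principally polarised Weil-type `ℤ[ζ₁₆]`-fourfolds for `ℚ(i)` lie on the SPLIT row W4.1.1 — the
  factor `2 = √N(𝔡_{K/K⁺})` of the `2`-power level is a norm from `ℚ(i)` (and from `ℚ(√−2)`, part 95).

HONEST FRAMING as parts 82–93; `HC_CM` is used nowhere.  No `def`, no named fact, no `sorry`.  Certificates from
`work/py/gen16.py` (exact arithmetic in `ℚ[x]/(x⁸ + 1)`), re-verified by `linear_combination`.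

References: [cite: vanGeemen1994HodgeAV, Lemma 5.2 (2)–(4), 5.4 and (5.4.1)]; [cite: Shimura1998, §14.3 Prop. 4–5,
pp. 103–104]; census b01.46, b01.47 (seat-derived).
-/

noncomputable section

open Polynomial NumberField Module
open scoped nonZeroDivisors

namespace Summit.HodgeConjecture.Ring2WeilCoverage.WeilGramLevel16

open Literature.AlgebraicGeometry.VanGeemen1994 (weilField weilNormResidueGroup)
open Literature.AlgebraicGeometry.Motives (normUnitsSubgroup)
open Literature.NumberTheory.ComplexMultiplication
open Summit.HodgeConjecture.Ring2WeilCoverage.TraceGramDeterminant (trace_aeval_zeta_mul_inv)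
open Summit.HodgeConjecture.Ring2WeilCoverage.WeilGramCMPoint
open Summit.HodgeConjecture.Ring2WeilCoverage.RealUnitNormHalfSystems (complexConj_eq_inv)
open Summit.HodgeConjecture.Ring2WeilCoverage.CyclotomicPrincipalObstruction (complexConj_xi)
open Summit.HodgeConjecture.Ring2WeilCoverage.CyclotomicDifferent (isOfType_one_xi_top xi_ne_zero)
open Summit.HodgeConjecture.Ring2WeilCoverage.WeilGramSign (neg_one_pow_mul_det_realPart_pos)
open Literature.AlgebraicGeometry.Motives (CMType)
open Summit.HodgeConjecture.HodgeConjecture.Ring2.WeilCoverage (mk_eq_split_of_even mem_normUnitsSubgroup_of_sq_add_mul_sq)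
open Summit.HodgeConjecture.HodgeConjecture.Ring2.Hypotheses (splitDiscriminantClass)
open Summit.HodgeConjecture.Ring2WeilCoverage.WeilGramCMPoint (exists_real_eq_mul_of_skew exists_units_eq_mul_of_isOfType det_realPart_mul)
open Summit.HodgeConjecture.Ring2WeilCoverage.WeilGramLevel20 (aeval_poly₈)

variable {K : Type} [Field K] [NumberField K] {ζ : K}

/-! ### §0 Level lemmas -/

/-- `φ(16) = 8`. [folklore] -/
theorem totient_sixteen : Nat.totient 16 = 8 := by decide

omit [NumberField K] in
/-- **`Φ₁₆(ζ) = 0` written out**: `ζ⁸ + 1 = 0` (`(x⁸ − 1)Φ₁₆(x) = x¹⁶ − 1`, `ζ⁸ ≠ 1`).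
research route conditional on HC_CM; not a corollary; Q11.4-sentence-2 already refuted in dim ≥ 3. [folklore] -/
theorem cyc_sixteen (hζ : IsPrimitiveRoot ζ 16) : ζ ^ 8 + 1 = 0 := by
  have h16 : ζ ^ 16 = 1 := hζ.pow_eq_one
  have h8 : ζ ^ 8 - 1 ≠ 0 := sub_ne_zero.mpr (hζ.pow_ne_one_of_pos_of_lt (by norm_num) (by norm_num))
  have h : (ζ ^ 8 - 1) * (ζ ^ 8 + 1) = 0 := by linear_combination h16
  rcases mul_eq_zero.mp h with h' | h'
  · exact absurd h' h8
  · exact h'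

omit [NumberField K] in
/-- `θζ = ζ² + 1` for `θ = ζ + ζ⁻¹`. [folklore] -/
theorem theta_mul_zeta (hζ : IsPrimitiveRoot ζ 16) : (ζ + ζ⁻¹) * ζ = ζ ^ 2 + 1 := by
  have hζ0 : ζ ≠ 0 := hζ.ne_zero (by norm_num)
  rw [add_mul, inv_mul_cancel₀ hζ0]
  ring

omit [NumberField K] in
/-- `(ζ⁻¹)^a = ζ^b` when `a + b = 16`. [folklore] -/
theorem inv_pow_eq_pow (hζ : IsPrimitiveRoot ζ 16) {a b : ℕ} (hab : a + b = 16) : ζ⁻¹ ^ a = ζ ^ b := by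
  rw [inv_pow]
  apply inv_eq_of_mul_eq_one_right
  rw [← pow_add, hab, hζ.pow_eq_one]

/-- `θ = ζ + ζ⁻¹` is real. [folklore] -/
theorem complexConj_theta [IsCMField K] (hζ : IsPrimitiveRoot ζ 16) :
    IsCMField.complexConj K (ζ + ζ⁻¹) = ζ + ζ⁻¹ := by
  rw [map_add, map_inv₀, complexConj_eq_inv hζ, inv_inv, add_comm]

/-- The frame `xᵢ = θ^i` is real. [folklore] -/
theorem complexConj_thetaFrame [IsCMField K] (hζ : IsPrimitiveRoot ζ 16) {m : ℕ} {x : Fin m → K}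
    (hx : ∀ i, x i = (ζ + ζ⁻¹) ^ (i : ℕ)) (i : Fin m) : IsCMField.complexConj K (x i) = x i := by
  rw [hx i, map_pow, complexConj_theta hζ]

/-- `ξ = ζ³/Φ′(ζ)` is skew (part 7, `g − 1 = 3`). [folklore] -/
theorem complexConj_xi_sixteen [IsCMField K] (hζ : IsPrimitiveRoot ζ 16) :
    IsCMField.complexConj K (ζ ^ 3 * (aeval ζ (derivative (cyclotomic 16 ℚ)))⁻¹) =
      -(ζ ^ 3 * (aeval ζ (derivative (cyclotomic 16 ℚ)))⁻¹) :=
  complexConj_xi hζ (k := 3) (by rw [totient_sixteen])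

omit [NumberField K] in
/-- **`(ζ⁴)² = −1`**: `ζ⁴ = i`. [folklore] -/
theorem sq_sqrtNegOne (hζ : IsPrimitiveRoot ζ 16) : (ζ ^ 4) ^ 2 = -1 := by
  linear_combination cyc_sixteen hζ

/-- **`ζ⁴` is skew**: `(ζ⁴)^ρ = ζ¹² = −ζ⁴`. [folklore] -/
theorem complexConj_sqrtNegOne [IsCMField K] (hζ : IsPrimitiveRoot ζ 16) :
    IsCMField.complexConj K (ζ ^ 4) = -(ζ ^ 4) := by
  rw [map_pow, complexConj_eq_inv hζ, inv_pow_eq_pow hζ (show 4 + 12 = 16 by norm_num)]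
  linear_combination (ζ ^ 4) * cyc_sixteen hζ

/-! ### §0b The evaluation step: `Tr(y·θ^m)` from a certificate `y(ζ² + 1)^m = R(ζ)Φ′(ζ)⁻¹ζ^m` (part 81) -/

/-- `Tr_{K/ℚ}(y) = coeff₇(R)` if `y = R(ζ)/Φ′(ζ)` with `deg R ≤ 7` (part 81 `trace_aeval_zeta_mul_inv`). research route conditional on HC_CM; not a corollary; Q11.4-sentence-2 already refuted in dim ≥ 3. [folklore] -/
theorem trace_of_key₀ [IsCyclotomicExtension {16} ℚ K] (hζ : IsPrimitiveRoot ζ 16) {y : K} (R : ℚ[X])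
    (hR : R.natDegree ≤ 7) (hkey : y = aeval ζ R * (aeval ζ (derivative (cyclotomic 16 ℚ)))⁻¹) :
    Algebra.trace ℚ K y = R.coeff 7 := by
  rw [hkey, trace_aeval_zeta_mul_inv hζ R (by rw [totient_sixteen]; omega), totient_sixteen]

/-- `Tr_{K/ℚ}(y·θ) = coeff₇(R)` if `y(ζ² + 1) = R(ζ)Φ′(ζ)⁻¹·ζ` (`θζ = ζ² + 1`). research route conditional on HC_CM; not a corollary; Q11.4-sentence-2 already refuted in dim ≥ 3. [folklore] -/
theorem trace_of_key₁ [IsCyclotomicExtension {16} ℚ K] (hζ : IsPrimitiveRoot ζ 16) {y : K} (R : ℚ[X])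
    (hR : R.natDegree ≤ 7) (hkey : y * (ζ ^ 2 + 1) = aeval ζ R * (aeval ζ (derivative (cyclotomic 16 ℚ)))⁻¹ * ζ) :
    Algebra.trace ℚ K (y * (ζ + ζ⁻¹)) = R.coeff 7 := by
  have hζ0 : ζ ≠ 0 := hζ.ne_zero (by norm_num)
  refine trace_of_key₀ hζ R hR (mul_right_cancel₀ hζ0 ?_)
  rw [mul_assoc, theta_mul_zeta hζ, hkey]

/-- `Tr_{K/ℚ}(y·θ^m) = coeff₇(R)` if `y(ζ² + 1)^m = R(ζ)Φ′(ζ)⁻¹·ζ^m` (`θ^m ζ^m = (ζ² + 1)^m`). research route conditional on HC_CM; not a corollary; Q11.4-sentence-2 already refuted in dim ≥ 3. [folklore] -/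
theorem trace_of_key [IsCyclotomicExtension {16} ℚ K] (hζ : IsPrimitiveRoot ζ 16) {y : K} {m : ℕ} (R : ℚ[X])
    (hR : R.natDegree ≤ 7) (hkey : y * (ζ ^ 2 + 1) ^ m = aeval ζ R * (aeval ζ (derivative (cyclotomic 16 ℚ)))⁻¹ * ζ ^ m) :
    Algebra.trace ℚ K (y * (ζ + ζ⁻¹) ^ m) = R.coeff 7 := by
  have hζ0 : ζ ≠ 0 := hζ.ne_zero (by norm_num)
  refine trace_of_key₀ hζ R hR (mul_right_cancel₀ (pow_ne_zero m hζ0) ?_)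
  rw [mul_assoc, ← mul_pow, theta_mul_zeta hζ, hkey]

/-! ### §1 The principal-type form `E_ξ` for `K_d = ℚ(i)`: seven traces, the Hankel matrix, `det = 8` -/

/-- `Tr(ζ′sθ^0) = 1` for `ζ′ = ξ = ζ³/Φ′(ζ)`, `s = √−1 = ζ⁴`, `θ = ζ + ζ⁻¹` (Euler evaluation). research route conditional on HC_CM; not a corollary; Q11.4-sentence-2 already refuted in dim ≥ 3. [folklore] -/
theorem trace_xi_sqrtNegOne_zero [IsCyclotomicExtension {16} ℚ K] (hζ : IsPrimitiveRoot ζ 16) :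
    Algebra.trace ℚ K ((ζ ^ 3 * (aeval ζ (derivative (cyclotomic 16 ℚ)))⁻¹) * ζ ^ 4) = 1 := by
  rw [trace_of_key₀ hζ (C (0 : ℚ) + C (0 : ℚ) * X + C (0 : ℚ) * X ^ 2 + C (0 : ℚ) * X ^ 3 + C (0 : ℚ) * X ^ 4 + C (0 : ℚ) * X ^ 5 +
      C (0 : ℚ) * X ^ 6 + C (1 : ℚ) * X ^ 7) (by compute_degree) (by
    rw [aeval_poly₈]
    push_cast
    ring)]
  norm_num [coeff_X_pow, coeff_X, coeff_C, coeff_one]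

/-- `Tr(ζ′sθ^1) = 0` for `ζ′ = ξ = ζ³/Φ′(ζ)`, `s = √−1 = ζ⁴`, `θ = ζ + ζ⁻¹` (Euler evaluation). research route conditional on HC_CM; not a corollary; Q11.4-sentence-2 already refuted in dim ≥ 3. [folklore] -/
theorem trace_xi_sqrtNegOne_one [IsCyclotomicExtension {16} ℚ K] (hζ : IsPrimitiveRoot ζ 16) :
    Algebra.trace ℚ K ((ζ ^ 3 * (aeval ζ (derivative (cyclotomic 16 ℚ)))⁻¹) * ζ ^ 4 * (ζ + ζ⁻¹)) = 0 := by
  have hΦ := cyc_sixteen hζ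
  rw [trace_of_key₁ hζ (C (-1 : ℚ) + C (0 : ℚ) * X + C (0 : ℚ) * X ^ 2 + C (0 : ℚ) * X ^ 3 + C (0 : ℚ) * X ^ 4 + C (0 : ℚ) * X ^ 5 +
      C (1 : ℚ) * X ^ 6 + C (0 : ℚ) * X ^ 7) (by compute_degree) (by
    rw [aeval_poly₈]
    push_cast
    linear_combination ((aeval ζ (derivative (cyclotomic 16 ℚ)))⁻¹ * (ζ)) * hΦ)]
  norm_num [coeff_X_pow, coeff_X, coeff_C, coeff_one]

/-- `Tr(ζ′sθ^2) = 2` for `ζ′ = ξ = ζ³/Φ′(ζ)`, `s = √−1 = ζ⁴`, `θ = ζ + ζ⁻¹` (Euler evaluation). research route conditional on HC_CM; not a corollary; Q11.4-sentence-2 already refuted in dim ≥ 3. [folklore] -/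
theorem trace_xi_sqrtNegOne_two [IsCyclotomicExtension {16} ℚ K] (hζ : IsPrimitiveRoot ζ 16) :
    Algebra.trace ℚ K ((ζ ^ 3 * (aeval ζ (derivative (cyclotomic 16 ℚ)))⁻¹) * ζ ^ 4 * (ζ + ζ⁻¹) ^ 2) = 2 := by
  have hΦ := cyc_sixteen hζ
  rw [trace_of_key hζ (C (0 : ℚ) + C (-1 : ℚ) * X + C (0 : ℚ) * X ^ 2 + C (0 : ℚ) * X ^ 3 + C (0 : ℚ) * X ^ 4 + C (1 : ℚ) * X ^ 5 +
      C (0 : ℚ) * X ^ 6 + C (2 : ℚ) * X ^ 7) (by compute_degree) (by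
    rw [aeval_poly₈]
    push_cast
    linear_combination ((aeval ζ (derivative (cyclotomic 16 ℚ)))⁻¹ * (ζ^3)) * hΦ)]
  norm_num [coeff_X_pow, coeff_X, coeff_C, coeff_one]

/-- `Tr(ζ′sθ^3) = 0` for `ζ′ = ξ = ζ³/Φ′(ζ)`, `s = √−1 = ζ⁴`, `θ = ζ + ζ⁻¹` (Euler evaluation). research route conditional on HC_CM; not a corollary; Q11.4-sentence-2 already refuted in dim ≥ 3. [folklore] -/
theorem trace_xi_sqrtNegOne_three [IsCyclotomicExtension {16} ℚ K] (hζ : IsPrimitiveRoot ζ 16) :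
    Algebra.trace ℚ K ((ζ ^ 3 * (aeval ζ (derivative (cyclotomic 16 ℚ)))⁻¹) * ζ ^ 4 * (ζ + ζ⁻¹) ^ 3) = 0 := by
  have hΦ := cyc_sixteen hζ
  rw [trace_of_key hζ (C (-3 : ℚ) + C (0 : ℚ) * X + C (-1 : ℚ) * X ^ 2 + C (0 : ℚ) * X ^ 3 + C (1 : ℚ) * X ^ 4 +
      C (0 : ℚ) * X ^ 5 + C (3 : ℚ) * X ^ 6 + C (0 : ℚ) * X ^ 7) (by compute_degree) (by
    rw [aeval_poly₈]
    push_cast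
    linear_combination ((aeval ζ (derivative (cyclotomic 16 ℚ)))⁻¹ * (3 * ζ^3 + ζ^5)) * hΦ)]
  norm_num [coeff_X_pow, coeff_X, coeff_C, coeff_one]

/-- `Tr(ζ′sθ^4) = 6` for `ζ′ = ξ = ζ³/Φ′(ζ)`, `s = √−1 = ζ⁴`, `θ = ζ + ζ⁻¹` (Euler evaluation). research route conditional on HC_CM; not a corollary; Q11.4-sentence-2 already refuted in dim ≥ 3. [folklore] -/
theorem trace_xi_sqrtNegOne_four [IsCyclotomicExtension {16} ℚ K] (hζ : IsPrimitiveRoot ζ 16) :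
    Algebra.trace ℚ K ((ζ ^ 3 * (aeval ζ (derivative (cyclotomic 16 ℚ)))⁻¹) * ζ ^ 4 * (ζ + ζ⁻¹) ^ 4) = 6 := by
  have hΦ := cyc_sixteen hζ
  rw [trace_of_key hζ (C (0 : ℚ) + C (-4 : ℚ) * X + C (0 : ℚ) * X ^ 2 + C (0 : ℚ) * X ^ 3 + C (0 : ℚ) * X ^ 4 + C (4 : ℚ) * X ^ 5 +
      C (0 : ℚ) * X ^ 6 + C (6 : ℚ) * X ^ 7) (by compute_degree) (by
    rw [aeval_poly₈]
    push_cast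
    linear_combination ((aeval ζ (derivative (cyclotomic 16 ℚ)))⁻¹ * (4 * ζ^5 + ζ^7)) * hΦ)]
  norm_num [coeff_X_pow, coeff_X, coeff_C, coeff_one]

/-- `Tr(ζ′sθ^5) = 0` for `ζ′ = ξ = ζ³/Φ′(ζ)`, `s = √−1 = ζ⁴`, `θ = ζ + ζ⁻¹` (Euler evaluation). research route conditional on HC_CM; not a corollary; Q11.4-sentence-2 already refuted in dim ≥ 3. [folklore] -/
theorem trace_xi_sqrtNegOne_five [IsCyclotomicExtension {16} ℚ K] (hζ : IsPrimitiveRoot ζ 16) :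
    Algebra.trace ℚ K ((ζ ^ 3 * (aeval ζ (derivative (cyclotomic 16 ℚ)))⁻¹) * ζ ^ 4 * (ζ + ζ⁻¹) ^ 5) = 0 := by
  have h16 : ζ ^ 16 = 1 := hζ.pow_eq_one
  have hΦ := cyc_sixteen hζ
  rw [trace_of_key hζ (C (-10 : ℚ) + C (0 : ℚ) * X + C (-4 : ℚ) * X ^ 2 + C (0 : ℚ) * X ^ 3 + C (4 : ℚ) * X ^ 4 +
      C (0 : ℚ) * X ^ 5 + C (10 : ℚ) * X ^ 6 + C (0 : ℚ) * X ^ 7) (by compute_degree) (by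
    rw [aeval_poly₈]
    push_cast
    linear_combination ((aeval ζ (derivative (cyclotomic 16 ℚ)))⁻¹ * (ζ + 10 * ζ^5 + 5 * ζ^7)) * hΦ +
      ((aeval ζ (derivative (cyclotomic 16 ℚ)))⁻¹ * (ζ)) * h16)]
  norm_num [coeff_X_pow, coeff_X, coeff_C, coeff_one]

/-- `Tr(ζ′sθ^6) = 20` for `ζ′ = ξ = ζ³/Φ′(ζ)`, `s = √−1 = ζ⁴`, `θ = ζ + ζ⁻¹` (Euler evaluation). research route conditional on HC_CM; not a corollary; Q11.4-sentence-2 already refuted in dim ≥ 3. [folklore] -/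
theorem trace_xi_sqrtNegOne_six [IsCyclotomicExtension {16} ℚ K] (hζ : IsPrimitiveRoot ζ 16) :
    Algebra.trace ℚ K ((ζ ^ 3 * (aeval ζ (derivative (cyclotomic 16 ℚ)))⁻¹) * ζ ^ 4 * (ζ + ζ⁻¹) ^ 6) = 20 := by
  have h16 : ζ ^ 16 = 1 := hζ.pow_eq_one
  have hΦ := cyc_sixteen hζ
  rw [trace_of_key hζ (C (0 : ℚ) + C (-14 : ℚ) * X + C (0 : ℚ) * X ^ 2 + C (0 : ℚ) * X ^ 3 + C (0 : ℚ) * X ^ 4 +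
      C (14 : ℚ) * X ^ 5 + C (0 : ℚ) * X ^ 6 + C (20 : ℚ) * X ^ 7) (by compute_degree) (by
    rw [aeval_poly₈]
    push_cast
    linear_combination ((aeval ζ (derivative (cyclotomic 16 ℚ)))⁻¹ * (6 * ζ + ζ^3 + 15 * ζ^7)) * hΦ +
      ((aeval ζ (derivative (cyclotomic 16 ℚ)))⁻¹ * (6 * ζ + ζ^3)) * h16)]
  norm_num [coeff_X_pow, coeff_X, coeff_C, coeff_one]

/-- **The Gram datum `a` of `(E_ζ′, s)` in the real frame `θ^i` (`i < 4`)** for `ζ′ = ξ = ζ³/Φ′(ζ)` (principal type (1)),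
`s = √−1 = ζ⁴`: the integer Hankel matrix `(−Tr(ζ′sθ^{i+j}))ᵢⱼ` (and `b = 0`, part 82 `hb_eq_zero`).
research route conditional on HC_CM; not a corollary; Q11.4-sentence-2 already refuted in dim ≥ 3. [cite: vanGeemen1994HodgeAV, Lemma 5.2 (2)–(3)] -/
theorem realPart_xi_sqrtNegOne [IsCyclotomicExtension {16} ℚ K] [IsCMField K] (hζ : IsPrimitiveRoot ζ 16)
    {x : Fin 4 → K} (hx : ∀ i, x i = (ζ + ζ⁻¹) ^ (i : ℕ)) {a : Matrix (Fin 4) (Fin 4) ℚ}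
    (ha : ∀ i j, a i j = Algebra.trace ℚ K ((ζ ^ 3 * (aeval ζ (derivative (cyclotomic 16 ℚ)))⁻¹) * x i * IsCMField.complexConj K (ζ ^ 4 * x j))) :
    a = !![-1, 0, -2, 0; 0, -2, 0, -6; -2, 0, -6, 0; 0, -6, 0, -20] := by
  rw [ha_eq (complexConj_sqrtNegOne hζ) (complexConj_thetaFrame hζ hx) ha]
  ext i j
  simp only [Matrix.of_apply, hx, ← pow_add]
  fin_cases i <;> fin_cases j <;> simp [trace_xi_sqrtNegOne_zero hζ, trace_xi_sqrtNegOne_one hζ, trace_xi_sqrtNegOne_two hζ, trace_xi_sqrtNegOne_three hζ, trace_xi_sqrtNegOne_four hζ, trace_xi_sqrtNegOne_five hζ, trace_xi_sqrtNegOne_six hζ]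

/-- **`det a = 8`** for `ζ′ = ξ = ζ³/Φ′(ζ)`, `s = √−1 = ζ⁴` (frame `θ^i`). research route conditional on HC_CM; not a corollary; Q11.4-sentence-2 already refuted in dim ≥ 3. [cite: vanGeemen1994HodgeAV, Lemma 5.2 (3)] -/
theorem det_realPart_xi_sqrtNegOne [IsCyclotomicExtension {16} ℚ K] [IsCMField K] (hζ : IsPrimitiveRoot ζ 16)
    {x : Fin 4 → K} (hx : ∀ i, x i = (ζ + ζ⁻¹) ^ (i : ℕ)) {a : Matrix (Fin 4) (Fin 4) ℚ}
    (ha : ∀ i j, a i j = Algebra.trace ℚ K ((ζ ^ 3 * (aeval ζ (derivative (cyclotomic 16 ℚ)))⁻¹) * x i * IsCMField.complexConj K (ζ ^ 4 * x j))) :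
    a.det = 8 := by
  rw [realPart_xi_sqrtNegOne hζ hx ha]
  simp [Matrix.det_succ_row_zero, Fin.sum_univ_succ, Fin.succAbove, Matrix.submatrix]
  norm_num

/-! ### §3 `1, θ, θ², θ³` is a `ℚ`-basis of `K⁺ = ℚ(ζ_16)⁺` -/

/-- `[ℚ(ζ_16)⁺ : ℚ] = 4`. [folklore] -/
theorem finrank_realSubfield [IsCyclotomicExtension {16} ℚ K] [IsCMField K] :
    finrank ℚ (maximalRealSubfield K) = 4 := by
  have h1 : finrank ℚ K = 8 := by
    rw [IsCyclotomicExtension.finrank K (cyclotomic.irreducible_rat (by norm_num : 0 < 16))]; decide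
  have h2 := Module.finrank_mul_finrank ℚ (maximalRealSubfield K) K
  rw [Algebra.IsQuadraticExtension.finrank_eq_two (maximalRealSubfield K) K, h1] at h2
  omega

/-- **`1, θ, θ², θ³` are `ℚ`-linearly independent in `K⁺`**: a relation `Σ cₖ θ^k = 0`, multiplied by `ξ s θ^m` and
traced, gives the Hankel system of §1 (`m ≤ 3`), whose determinant is non-zero.
research route conditional on HC_CM; not a corollary; Q11.4-sentence-2 already refuted in dim ≥ 3. [folklore] -/
theorem linearIndependent_thetaPow [IsCyclotomicExtension {16} ℚ K] [IsCMField K] (hζ : IsPrimitiveRoot ζ 16)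
    {ω : Fin 4 → maximalRealSubfield K} (hω : ∀ i, (ω i : K) = (ζ + ζ⁻¹) ^ (i : ℕ)) : LinearIndependent ℚ ω := by
  rw [Fintype.linearIndependent_iff]
  intro c hc
  have hcK : ∑ i : Fin 4, (c i : K) * (ζ + ζ⁻¹) ^ (i : ℕ) = 0 := by
    have h := congrArg (fun y : maximalRealSubfield K => (y : K)) hc
    simp only [ZeroMemClass.coe_zero] at h
    rw [← h]
    push_cast
    refine Finset.sum_congr rfl fun i _ => ?_
    rw [Rat.smul_def, hω i]
  have E : ∀ m : ℕ, ∑ i : Fin 4, c i * Algebra.trace ℚ K ((ζ ^ 3 * (aeval ζ (derivative (cyclotomic 16 ℚ)))⁻¹) * ζ ^ 4 *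
      (ζ + ζ⁻¹) ^ (m + (i : ℕ))) = 0 := by
    intro m
    have h := congrArg (fun y => Algebra.trace ℚ K ((ζ ^ 3 * (aeval ζ (derivative (cyclotomic 16 ℚ)))⁻¹) * ζ ^ 4 * (ζ + ζ⁻¹) ^ m * y)) hcK
    simp only [mul_zero, map_zero, Finset.mul_sum, map_sum] at h
    rw [← h]
    refine Finset.sum_congr rfl fun i _ => ?_
    rw [show (ζ ^ 3 * (aeval ζ (derivative (cyclotomic 16 ℚ)))⁻¹) * ζ ^ 4 * (ζ + ζ⁻¹) ^ m *
        ((c i : K) * (ζ + ζ⁻¹) ^ (i : ℕ)) = (c i) • ((ζ ^ 3 * (aeval ζ (derivative (cyclotomic 16 ℚ)))⁻¹) * ζ ^ 4 *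
        (ζ + ζ⁻¹) ^ (m + (i : ℕ))) by rw [Rat.smul_def, pow_add]; ring, map_smul, smul_eq_mul]
  have e0 := E 0
  have e1 := E 1
  have e2 := E 2
  have e3 := E 3
  simp only [Fin.sum_univ_four, Fin.isValue, Fin.val_zero, Fin.val_one, Fin.val_two, show ((3 : Fin 4) : ℕ) = 3 from rfl,
    Nat.reduceAdd, zero_add, add_zero, pow_zero, mul_one, pow_one, trace_xi_sqrtNegOne_zero hζ, trace_xi_sqrtNegOne_one hζ, trace_xi_sqrtNegOne_two hζ, trace_xi_sqrtNegOne_three hζ, trace_xi_sqrtNegOne_four hζ, trace_xi_sqrtNegOne_five hζ, trace_xi_sqrtNegOne_six hζ] at e0 e1 e2 e3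
  have c0 : c 0 = 0 := by linear_combination (3 : ℚ) * e0 + (-1 : ℚ) * e2
  have c1 : c 1 = 0 := by linear_combination (5 : ℚ) * e1 + ((-3 : ℚ) / 2) * e3
  have c2 : c 2 = 0 := by linear_combination (-1 : ℚ) * e0 + ((1 : ℚ) / 2) * e2
  have c3 : c 3 = 0 := by linear_combination ((-3 : ℚ) / 2) * e1 + ((1 : ℚ) / 2) * e3
  intro i
  fin_cases i
  · exact c0
  · exact c1
  · exact c2
  · exact c3

/-- **A `ℚ`-basis `ωb` of `K⁺ = ℚ(ζ_16)⁺ with `ωb i = θ^i`** (`i < 4`). [folklore] -/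
theorem exists_basis_thetaPow [IsCyclotomicExtension {16} ℚ K] [IsCMField K] (hζ : IsPrimitiveRoot ζ 16) :
    ∃ ωb : Basis (Fin 4) ℚ (maximalRealSubfield K), ∀ i, (ωb i : K) = (ζ + ζ⁻¹) ^ (i : ℕ) := by
  let θ' : maximalRealSubfield K :=
    ⟨ζ + ζ⁻¹, (IsCMField.complexConj_eq_self_iff K (ζ + ζ⁻¹)).mp (complexConj_theta hζ)⟩
  let ω : Fin 4 → maximalRealSubfield K := fun i => θ' ^ (i : ℕ)
  have hω : ∀ i, (ω i : K) = (ζ + ζ⁻¹) ^ (i : ℕ) := fun i => by simp [ω, θ']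
  have hli := linearIndependent_thetaPow hζ hω
  have hcard : Fintype.card (Fin 4) = finrank ℚ (maximalRealSubfield K) := by
    rw [Fintype.card_fin, finrank_realSubfield]
  exact ⟨basisOfLinearIndependentOfCardEqFinrank hli hcard, fun i => by
    rw [coe_basisOfLinearIndependentOfCardEqFinrank]; exact hω i⟩

/-! ### §4 Principal-type parameters at the exceptional level: `det a = ±8`, and `= +8` for the `Φ`-positive ones -/

/-- **At level `16`, every skew `ζ′` of PRINCIPAL type on `ℤ[ζ₁₆]` has `det a = N(u)·8` for a unit `u` of `𝓞 K⁺`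
(`ζ′ = uξ`; `N(u) = ±1` — units of norm `−1` DO exist here, part 73), hence `det a = 8 ∨ det a = −8`.**
research route conditional on HC_CM; not a corollary; Q11.4-sentence-2 already refuted in dim ≥ 3. [cite: vanGeemen1994HodgeAV, Lemma 5.2 (3)] [cite: Shimura1998, §14.3 Prop. 5, p. 104] -/
theorem det_realPart_principal_sqrtNegOne_or [IsCyclotomicExtension {16} ℚ K] [IsCMField K]
    (hζ : IsPrimitiveRoot ζ 16) {ζ' : K} (hζ' : IsCMField.complexConj K ζ' = -ζ')
    (hT : CMTypeLattice.IsOfType (1 : (FractionalIdeal (𝓞 K)⁰ K)ˣ) ζ' ⊤)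
    {x : Fin 4 → K} (hx : ∀ i, x i = (ζ + ζ⁻¹) ^ (i : ℕ)) {a : Matrix (Fin 4) (Fin 4) ℚ}
    (ha : ∀ i j, a i j = Algebra.trace ℚ K (ζ' * x i * IsCMField.complexConj K (ζ ^ 4 * x j))) :
    a.det = 8 ∨ a.det = -8 := by
  obtain ⟨ωb, hωb⟩ := exists_basis_thetaPow hζ
  have hx' : ∀ i, x i = (ωb i : K) := fun i => (hx i).trans (hωb i).symm
  obtain ⟨γ₀, hγ⟩ := exists_real_eq_mul_of_skew (complexConj_xi_sixteen hζ) (complexConj_sqrtNegOne hζ)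
  obtain ⟨u, hu⟩ := exists_units_eq_mul_of_isOfType (complexConj_xi_sixteen hζ) (xi_ne_zero hζ 3) hζ'
    (isOfType_one_xi_top hζ 3) hT
  have h8 := det_realPart_xi_sqrtNegOne hζ hx (a := Matrix.of fun i j => Algebra.trace ℚ K
    ((ζ ^ 3 * (aeval ζ (derivative (cyclotomic 16 ℚ)))⁻¹) * x i * IsCMField.complexConj K (ζ ^ 4 * x j)))
    (fun i j => rfl)
  have hmul := det_realPart_mul ωb (complexConj_sqrtNegOne hζ) hx' hγ
    (β₀ := ((u : 𝓞 (maximalRealSubfield K)) : maximalRealSubfield K))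
    (a := Matrix.of fun i j => Algebra.trace ℚ K
      ((ζ ^ 3 * (aeval ζ (derivative (cyclotomic 16 ℚ)))⁻¹) * x i * IsCMField.complexConj K (ζ ^ 4 * x j)))
    (a' := a) (fun i j => rfl) (fun i j => by rw [ha, hu])
  rw [h8] at hmul
  have hn := NumberField.Units.norm (maximalRealSubfield K) u
  rcases abs_eq (by norm_num : (0 : ℚ) ≤ 1) |>.mp hn with h1 | h1
  · left; rw [hmul, h1]; norm_num
  · right; rw [hmul, h1]; norm_num

open scoped Classical in
/-- **`det a = +8` for a `Φ`-POSITIVE principal-type `ζ′` on a CM type `Φ` of `ζ⁴`-signature `(2, 2)`** — van Geemen's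
sign `0 < (−1)² det a` (part 92) excludes `−8`; such `ζ′` exist for every `Φ` (part 76 `exists_principal_sixteen`): the
principally polarised Weil-type `ℤ[ζ₁₆]`-fourfolds for `ℚ(√−1)` have `det H = 8`, class `[8] = [1]` — the SPLIT row W4.1.1 `= (2, ℚ(i), 1)`.
research route conditional on HC_CM; not a corollary; Q11.4-sentence-2 already refuted in dim ≥ 3. [cite: vanGeemen1994HodgeAV, Lemma 5.2 (3)–(4) and (5.4.1)] [cite: Shimura1998, §14.3 Prop. 4–5, pp. 103–104] -/
theorem det_realPart_principal_pos_sqrtNegOne [IsCyclotomicExtension {16} ℚ K] [IsCMField K]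
    (hζ : IsPrimitiveRoot ζ 16) (Φ : CMType K)
    (hneg : (Finset.univ.filter fun φ : Φ.1 => (φ.1 (ζ ^ 4)).im < 0).card = 2)
    (hposc : (Finset.univ.filter fun φ : Φ.1 => 0 < (φ.1 (ζ ^ 4)).im).card = 2)
    {ζ' : K} (hζ' : IsCMField.complexConj K ζ' = -ζ') (hpos : ∀ φ : Φ.1, 0 < (φ.1 ζ').im)
    (hT : CMTypeLattice.IsOfType (1 : (FractionalIdeal (𝓞 K)⁰ K)ˣ) ζ' ⊤)
    {x : Fin 4 → K} (hx : ∀ i, x i = (ζ + ζ⁻¹) ^ (i : ℕ)) {a : Matrix (Fin 4) (Fin 4) ℚ}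
    (ha : ∀ i j, a i j = Algebra.trace ℚ K (ζ' * x i * IsCMField.complexConj K (ζ ^ 4 * x j))) :
    a.det = 8 := by
  obtain ⟨ωb, hωb⟩ := exists_basis_thetaPow hζ
  have hx' : ∀ i, x i = (ωb i : K) := fun i => (hx i).trans (hωb i).symm
  have hs := complexConj_sqrtNegOne hζ
  have hs0 : (ζ ^ 4 : K) ≠ 0 := fun h => by
    have h2 := sq_sqrtNegOne hζ
    rw [h] at h2
    norm_num at h2
  have hζ'0 : ζ' ≠ 0 := by
    obtain ⟨φ, -⟩ := Finset.card_pos.mp (by rw [hposc]; norm_num :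
      0 < (Finset.univ.filter fun φ : Φ.1 => 0 < (φ.1 (ζ ^ 4)).im).card)
    intro h0
    have := hpos φ
    rw [h0, map_zero, Complex.zero_im] at this
    exact lt_irrefl _ this
  obtain ⟨γ₀, hγ⟩ := exists_real_eq_mul_of_skew hζ' hs
  have hsign := neg_one_pow_mul_det_realPart_pos Φ ωb hζ' hs hs0 hζ'0 hpos hneg hposc hx' hγ ha
  rcases det_realPart_principal_sqrtNegOne_or hζ hζ' hT hx ha with h | h
  · exact h
  · rw [h] at hsign; norm_num at hsign

/-- **`[8] = [1]`, the SPLIT class, in `ℚˣ/Nm(ℚ(√−1)ˣ)`** (`8 = 2² + 1·2²`): the SPLIT row W4.1.1 `= (2, ℚ(i), 1)`.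
research route conditional on HC_CM; not a corollary; Q11.4-sentence-2 already refuted in dim ≥ 3. [cite: vanGeemen1994HodgeAV, 5.4 and (5.4.1)] -/
theorem mk0_det_principal_sqrtNegOne :
    (QuotientGroup.mk (Units.mk0 (8 : ℚ) (by norm_num)) : weilNormResidueGroup 1) = splitDiscriminantClass 2 1 :=
  mk_eq_split_of_even (by decide) _ (mem_normUnitsSubgroup_of_sq_add_mul_sq _ (2 : ℚ) (2 : ℚ) (by norm_num))

end Summit.HodgeConjecture.Ring2WeilCoverage.WeilGramLevel16

end
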